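import Summits.CriticalPhenomena.PercolationContinuityZ3.Theorems.Transplant.SkelPhiRoot
import Summits.CriticalPhenomena.PercolationContinuityZ3.Theorems.Transplant.KNCells2RootRunTwoUnit
import Summits.CriticalPhenomena.PercolationContinuityZ3.Theorems.Transplant.KNCells2ChainS
import HarnessLib

/-!
# D″ node, (R) layer, file 3 (R-RECUT-PLAN §1 row 2; DPRIME-SCOPE p3 addendum M, rulings R1/R2, M.9 (3)): the root residue
# `Skelφ.RootOblS` of the two-unit scheme of record FROM THE PLANAR ROOT BAND RUN — `Skelφ.rootOblS_concSG` (file 2, `SkelPhiRoot`) with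
# the schedule := p1-g9's ROOTED BAND RUN `ChainPlanar.Band.scheduleR` (`KNCells2ChainS`) placed about the root centre `rootCtr du ca cb`
# with `q := 0` (M.9 (3): the start box IS the landing row of the first hop), its admissibility against the two units `RootRun2.RootBandOK`
# (my `KNCells2RootRunTwoUnit` signed-box facts), the window-chain data `Skelφ.rootWCD` (source `w₀`, rim parts = region-window vertices
# deeper than `Rt − L'`): the three planar facts, the rim parts inside the regions AND the nonemptiness of the true targets (from `Steps`)
# are discharged — the φ-level successor of p2-g4's `SkelConcRootRun` (`Skel.rootWAD`, `Skel.rootOblA_of_rootRunSG`)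

builds on p205010 (kernel theorem, internal audit signed; external expert review pending) — nothing in this file uses p205010.
Status sentence (coordinator 2026-08-20T04:30Z): "θ(p_c) = 0 on ℤ^d, all d ≥ 2 — kernel-verified (Lean 4/Mathlib, standard axioms); internal
adversarial audit SIGNED 2026-08-20 04:29Z; external expert review pending."
Lane `prim-bschramm-*`, seat `prim-bschramm-p2` (gen 8; (R) = p2 lineage under D″); helper file (`--supports stmt-CriticalPhenomena-4575`).

THE ROOT BAND RUN in direction `du` (axis `a = du.1`, sign `σ = sgOf du`, run-axis unit `r∥ = P.r a`, transverse unit `r⊥ = P.r (oth a)`):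
centre `rootCtr du ca cb` (level `ca` along `du`, transverse `cb`), start box = the ROW `{level = ca, |trans − cb| ≤ q'}` (`q = 0`), `N + 1`
band steps of spacing `s₁` (the Step-I′ unit `e_a`), route extents `ℓ ∈ [ℓ₀, s₁ + R']`, band spreads `Wb ℓ ≤ WM`, region half-width `ρ`,
rooted region `0` reaching `ρ₀ = s₁ + 2R'` below the row.  PLACEMENT (`RootBandOK`, all per direction): `BandOK 0 q' s₁ ρ R' ℓ₀ N WM Wb` and
`5 r∥ + 1 + ρ₀ ≤ ca` (every region above the wired root cube `Q 0`), `ca + (N+1) s₁ ≤ 25 r∥` and `|cb| + ρ ≤ 5 r⊥ − 1` (regions inside the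
NARROW between-box `BtwN 0 du ∪ Q (0 + du)`), `17 r∥ ≤ ca + (N+1) s₁ ≤ 23 r∥` and `|cb| + w₁ + N R' ≤ 3 r⊥` (far line core inside `M (0 + du)`).
The true targets are nonempty once `Rt ≥ 60 rmax`: a core point `x ∈ core (k+1) ⊆ BtwN 0 du ∪ Q (0 + du) ⊆ Cell 0 ∪ Cell (0 + du)` has
`|x_i| ≤ 30 r_i`, so `Steps` gives a vertex over it within depth `60 rmax` (`Skelφ.exists_mem_graphBall_φ_eq`).
* §1 (pure `Site 2`) `RootRun2.RootBandOK`, **`RootRun2.rootSched`** (`:= Band.scheduleR a (sgOf_sign du) (rootCtr du ca cb) _ _`, `ℓ₁ := s₁ + R'`),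
  its `rfl` unfoldings, **`rootSched_region_subset`**, **`rootSched_region_disjoint_Q`**, **`rootSched_core_last_subset_M`**,
  `rootSched_core_subset`, `natAbs_add_le_of_mem_root_region₂`;
* §2 **`Skelφ.rootWCD G φ w₀ Rt L' Sc Rlev Nc j₀ j₁ Sfin : WinChainData V`** (schedule-generic rim parts), `rootWCD_Rim_subset`,
  `not_mem_graphBall_of_mem_rootWCD_Rim`;
* §3 **`Skelφ.rootOblS_of_rootRunSG`**.
[cite: KozmaNitzan2024, §4 p. 28 ((32) at the root), Lemma 11 (pp. 22–23)]
-/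

noncomputable section

open MeasureTheory ProbabilityTheory
open scoped ENNReal Classical

namespace Summit.CriticalPhenomena.PercolationContinuityZ3.Theorems

namespace Transplant

/-! ## §1 Planar: the rooted band run about the root centre versus the two-unit cells -/

namespace RootRun2

open Literature.Probability.Percolation Literature.Probability.LatticeModels
open Literature.Probability.Percolation.KozmaNitzan
open Literature.Probability.Percolation.KozmaNitzan.Cells (oth oth_ne eq_oth_of_ne sgOf sgOf_sign stepVec_apply_fst stepVec_apply_oth)
open ChainPlanar
open BoxProdZ2 (rootCtr rootCtr_fst rootCtr_oth)

/-- **Admissible parameters of the root BAND run in direction `du`** (start row `q = 0` at level `ca`, transverse centre `cb`, half-width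
`q'`; `N + 1` band steps of spacing `s₁`; region half-width `ρ`): p1-g9's `BandOK` and the placement of the run above the wired root cube,
inside the narrow between-box, with the far line core inside `M (0 + du)` — measured in the run-axis unit `r∥ = P.r du.1` and the transverse
unit `r⊥ = P.r (oth du.1)`. [this work] -/
structure RootBandOK (P : PCells2) (du : MDir) (s₁ R' ℓ₀ N WM : ℕ) (Wb : ℕ → ℕ) (ca cb q' ρ : ℤ) : Prop
    extends Band.BandOK 0 q' (s₁ : ℤ) ρ R' ℓ₀ N WM Wb where
  /-- region `0` stays above the wired root cube: `5 r∥ + 1 ≤ ca − ρ₀`, `ρ₀ = s₁ + 2R'` -/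
  hlo : 5 * (P.r du.1 : ℤ) + 1 + Adv.ρ₀ 0 (s₁ : ℤ) R' ≤ ca
  /-- the run stays inside the child's cube: `ca + (N+1) s₁ ≤ 25 r∥` -/
  hhi : ca + ((N : ℤ) + 1) * s₁ ≤ 25 * (P.r du.1 : ℤ)
  /-- the regions stay inside the narrow between-box transversally -/
  htr : |cb| + ρ ≤ 5 * (P.r (oth du.1) : ℤ) - 1
  /-- the far line core reaches `M (0 + du)`: `17 r∥ ≤ ca + (N+1) s₁` -/
  hloM : 17 * (P.r du.1 : ℤ) ≤ ca + ((N : ℤ) + 1) * s₁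
  /-- the far line core stays inside `M (0 + du)`: `ca + (N+1) s₁ ≤ 23 r∥` -/
  hhiM : ca + ((N : ℤ) + 1) * s₁ ≤ 23 * (P.r du.1 : ℤ)
  /-- the far line core stays inside `M (0 + du)` transversally -/
  htrM : |cb| + Band.w₁ q' R' WM + (N : ℤ) * R' ≤ 3 * (P.r (oth du.1) : ℤ)

variable {P : PCells2} {du : MDir} {s₁ R' ℓ₀ N WM : ℕ} {Wb : ℕ → ℕ} {ca cb q' ρ : ℤ}

omit P du ca cb in
/-- The extent range of the band run: `2·0 + s₁ + R' ≤ s₁ + R'`. [folklore] -/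
theorem two_mul_zero_add_le : 2 * (0 : ℤ) + (s₁ : ℤ) + R' ≤ ((s₁ + R' : ℕ) : ℤ) := by push_cast; omega

/-- **The root band run as a planar schedule**: p1-g9's rooted band run `Band.scheduleR` along `du.1` with sign `sgOf du` about the root
centre `rootCtr du ca cb`, start row `q = 0`, extents `≤ s₁ + R'`. [cite: KozmaNitzan2024, §4 Lemma 11 (pp. 22–23), p. 28] -/
def rootSched (P : PCells2) (du : MDir) (h : RootBandOK P du s₁ R' ℓ₀ N WM Wb ca cb q' ρ) : Schedule :=
  Band.scheduleR du.1 (sgOf_sign du) (rootCtr du ca cb) h.toBandOK (two_mul_zero_add_le (s₁ := s₁) (R' := R'))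

variable (h : RootBandOK P du s₁ R' ℓ₀ N WM Wb ca cb q' ρ)

/-- The regions of the root schedule are the rooted band regions. [folklore] -/
@[simp] theorem rootSched_region : (rootSched P du h).region = Band.regionR 0 (s₁ : ℤ) ρ R' du.1 (sgOf du) (rootCtr du ca cb) := rfl

/-- The cores of the root schedule are the band cores. [folklore] -/
@[simp] theorem rootSched_core (k : ℕ) : (rootSched P du h).core k = Band.core 0 q' (s₁ : ℤ) R' WM du.1 (sgOf du) (rootCtr du ca cb) k := rfl

/-- The axis of the root schedule. [folklore] -/
@[simp] theorem rootSched_ax (k : ℕ) : (rootSched P du h).ax k = du.1 := rfl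

/-- The band spread of the root schedule. [folklore] -/
@[simp] theorem rootSched_Wb (k : ℕ) : (rootSched P du h).Wb k = Wb := rfl

/-- The parameters of the root schedule. [folklore] -/
theorem rootSched_params : (rootSched P du h).N = N ∧ (rootSched P du h).R' = R' ∧ (rootSched P du h).ℓ₀ = ℓ₀ ∧
    (rootSched P du h).ℓ₁ = s₁ + R' ∧
    (rootSched P du h).prism = sBox du.1 (sgOf du) (rootCtr du ca cb) (-(Adv.ρ₀ 0 (s₁ : ℤ) R')) (0 + ((N : ℤ) + 1) * s₁) ρ :=
  ⟨rfl, rfl, rfl, rfl, rfl⟩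

/-- The number of steps of the root schedule. [folklore] -/
@[simp] theorem rootSched_N : (rootSched P du h).N = N := rfl

/-- The neighbourhood radius of the root schedule. [folklore] -/
@[simp] theorem rootSched_R' : (rootSched P du h).R' = R' := rfl

/-- **The start core of the root schedule is the landing row** `{level = ca, |trans − cb| ≤ q'}`. [folklore] -/
theorem rootSched_core_zero : (rootSched P du h).core 0 = sBox du.1 (sgOf du) (rootCtr du ca cb) (-0) 0 q' :=
  (Band.schedule_core_zero du.1 (sgOf_sign du) (rootCtr du ca cb) h.toBandOK (two_mul_zero_add_le (s₁ := s₁) (R' := R'))).2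

/-- **The last core of the root schedule is the far line core.** [folklore] -/
theorem rootSched_core_last : (rootSched P du h).core (N + 1) =
    sBox du.1 (sgOf du) (rootCtr du ca cb) (0 + ((N : ℤ) + 1) * s₁) (0 + ((N : ℤ) + 1) * s₁) (Band.w₁ q' R' WM + (N : ℤ) * R') :=
  (Band.schedule_core_last du.1 (sgOf_sign du) (rootCtr du ca cb) h.toBandOK (two_mul_zero_add_le (s₁ := s₁) (R' := R'))).2

include h in
/-- **Every region of the root band run lies in `BtwN 0 du ∪ Q (0 + du)`** (`k ≤ N`). [cite: KozmaNitzan2024, §4 p. 26 (E_{v,x}), Lemma 11 (p. 22: Ω)] -/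
theorem rootSched_region_subset {k : ℕ} (hk : k ≤ N) : (rootSched P du h).region k ⊆ P.BtwN 0 du ∪ P.Q ((0 : Site 2) + stepVec du) := by
  rw [rootSched_region]
  refine (Band.regionR_subset_prism (sgOf_sign du) (rootCtr du ca cb) h.toBandOK hk).trans ?_
  have hlo := h.hlo; have hhi := h.hhi
  exact sBox_rootCtr_subset_BtwN_union_Q P du ca cb (by linarith) (by linarith) h.htr

include h in
/-- **Every region of the root band run is off the root cube `Q 0`** (`k ≤ N`). [cite: KozmaNitzan2024, §4 p. 28] -/
theorem rootSched_region_disjoint_Q {k : ℕ} (hk : k ≤ N) : Disjoint ((rootSched P du h).region k) (P.Q 0) := by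
  rw [rootSched_region]
  refine Finset.disjoint_of_subset_left (Band.regionR_subset_prism (sgOf_sign du) (rootCtr du ca cb) h.toBandOK hk) ?_
  have hlo := h.hlo
  exact sBox_rootCtr_disjoint_Q_zero P du ca cb (hi := 0 + ((N : ℤ) + 1) * s₁) (w := ρ) (by linarith)

include h in
/-- **The far line core of the root band run lies in `M (0 + du)`.** [cite: KozmaNitzan2024, §4 p. 26 (M_v)] -/
theorem rootSched_core_last_subset_M : (rootSched P du h).core (N + 1) ⊆ P.M ((0 : Site 2) + stepVec du) := by
  rw [rootSched_core_last]
  have hloM := h.hloM; have hhiM := h.hhiM; have htrM := h.htrM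
  exact sBox_rootCtr_subset_M P du ca cb (by linarith) (by linarith) (by linarith)

include h in
/-- Every core `k ≤ N + 1` of the root band run lies in `BtwN 0 du ∪ Q (0 + du)` (core `0` through region `0`, core `k + 1` through region `k`).
[folklore] -/
theorem rootSched_core_subset {k : ℕ} (hk : k ≤ N + 1) : (rootSched P du h).core k ⊆ P.BtwN 0 du ∪ P.Q ((0 : Site 2) + stepVec du) := by
  rcases Nat.eq_zero_or_pos k with rfl | hpos
  · refine subset_trans ?_ (rootSched_region_subset h (k := 0) (Nat.zero_le _))
    have := (rootSched P du h).encl 0 (Nat.zero_le _)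
    refine subset_trans ?_ this
    rw [Schedule.core]
    refine Finset.Icc_subset_Icc (fun i => ?_) (fun i => ?_) <;>
      simp only [Pi.sub_apply, Pi.add_apply, Pi.natCast_apply] <;> omega
  · obtain ⟨k', rfl⟩ : ∃ k', k = k' + 1 := ⟨k - 1, by omega⟩
    exact ((rootSched P du h).core_succ_subset_region (by simp; omega)).trans (rootSched_region_subset h (by omega))

omit ca cb in
/-- A point of `BtwN 0 du ∪ Q (0 + du)` has ℓ¹-norm `≤ 60 rmax` (`⊆ Cell 0 ∪ Cell (0 + du)`, coordinates `≤ 30 r_i`). [folklore] -/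
theorem natAbs_add_le_of_mem_root_region₂ (P : PCells2) (du : MDir) {x : Site 2}
    (hx : x ∈ P.BtwN 0 du ∪ P.Q ((0 : Site 2) + stepVec du)) : (x 0).natAbs + (x 1).natAbs ≤ 60 * P.rmax := by
  have hx' : x ∈ P.Cell 0 ∪ P.Cell ((0 : Site 2) + stepVec du) := by
    rcases Finset.mem_union.1 hx with h' | h'
    · exact P.BtwN_subset_Cells 0 du h'
    · exact Finset.mem_union_right _ (P.Q_subset_Cell _ h')
  have hb : ∀ i, |x i| ≤ 30 * (P.rmax : ℤ) := by
    intro i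
    have hri : (P.r i : ℤ) ≤ P.rmax := by exact_mod_cast P.r_le_rmax i
    have hr0 : (0 : ℤ) ≤ P.r i := by positivity
    rcases Finset.mem_union.1 hx' with h' | h'
    · rw [PCells2.Cell, PCells2.mem_abox_iff] at h'
      have := h' i
      simp only [PCells2.cen_zero, Pi.zero_apply] at this
      push_cast at this
      rw [abs_le]; constructor <;> nlinarith [this.1, this.2]
    · rw [PCells2.Cell, PCells2.mem_abox_iff] at h'
      have := h' i
      rw [cen_stepVec] at this
      push_cast at this
      have hsv : |(if i = du.1 then 20 * (P.r du.1 : ℤ) * sgOf du else 0)| ≤ 20 * (P.r i : ℤ) := by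
        split_ifs with hi
        · subst hi
          have h20 : (0 : ℤ) ≤ 20 * (P.r du.1 : ℤ) := by positivity
          have hσ1 : |sgOf du| = 1 := by rcases sgOf_sign du with hs | hs <;> simp [hs]
          rw [abs_mul, hσ1, mul_one, abs_of_nonneg h20]
        · rw [abs_zero]; positivity
      rw [abs_le] at hsv ⊢
      constructor <;> nlinarith [hsv.1, hsv.2, this.1, this.2]
  have h0 := hb 0; have h1 := hb 1
  rw [← Int.natCast_natAbs] at h0 h1
  omega

end RootRun2

/-! ## §2 The window-chain data of the root probe -/

namespace Skelφ

open Literature.Probability.Percolation Literature.Probability.LatticeModels SimpleGraph GadgetSystem ProbeHistory HSiteScheme Contour KNCells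
open KNCells.KSchA KNLevels ChainPlanar
open Literature.Probability.Percolation.KozmaNitzan.Cells (sgOf sgOf_sign)
open Literature.Barriers.CriticalPhenomena (graphBall mem_graphBall_self graphBall_mono)
open BoxProdZ2 (ConcRadiiG rootCtr)
open Skel (winGraph)
open RootRun2 (RootBandOK rootSched rootSched_region_subset rootSched_region_disjoint_Q rootSched_core_last_subset_M rootSched_core_subset
  natAbs_add_le_of_mem_root_region₂)

variable {V : Type} (G : SimpleGraph V) [G.LocallyFinite] (φ : V → Site 2)

/-- **The window-chain data of the root probe** over the window of depth `Rt` about `w₀`, for ANY planar schedule `Sc`: level depth `Rlev`,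
contact count `Nc`, level window `[j₀, j₁]`, source `w₀`, support `Sfin`, rim parts = the region windows' vertices deeper than `Rt − L'`
(the shape `Skelφ.real_rim_le_of_radius` consumes). [cite: KozmaNitzan2024, §4 p. 28, Lemma 11, p. 20 (Step IV)] -/
def rootWCD (w₀ : V) (Rt L' : ℕ) (Sc : Schedule) (Rlev Nc j₀ j₁ : ℕ) (Sfin : Finset V) : WinChainData V where
  Rlev := Rlev
  N := Nc
  j₀ := j₀
  j₁ := j₁
  o := w₀
  Sfin := Sfin
  Rim := fun k => (Win G φ w₀ (Sc.region k) Rt).filter fun v => v ∉ graphBall G w₀ (Rt - L')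

variable {G φ}

/-- The rim parts lie in the regions (read through the plain planar window of depth `Rt`). [folklore] -/
theorem rootWCD_Rim_subset (hlip : Lip G φ) (w₀ : V) (Rt L' : ℕ) (Sc : Schedule) (Rlev Nc j₀ j₁ : ℕ) (Sfin : Finset V) (k : ℕ) :
    (rootWCD G φ w₀ Rt L' Sc Rlev Nc j₀ j₁ Sfin).Rim k ⊆ (planarWindowWin hlip w₀ Rt).stepD Sc k :=
  Finset.filter_subset _ _

/-- The rim parts are deeper than `Rt − L'`. [folklore] -/
theorem not_mem_graphBall_of_mem_rootWCD_Rim {w₀ : V} {Rt L' : ℕ} {Sc : Schedule} {Rlev Nc j₀ j₁ : ℕ} {Sfin : Finset V} {k : ℕ} {v : V}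
    (hv : v ∈ (rootWCD G φ w₀ Rt L' Sc Rlev Nc j₀ j₁ Sfin).Rim k) : v ∉ graphBall G w₀ (Rt - L') :=
  (Finset.mem_filter.1 hv).2

/-- A vertex of a rim part lies in the region window and has depth in `(Rt − L', Rt]`. [folklore] -/
theorem mem_rootWCD_Rim_iff {w₀ : V} {Rt L' : ℕ} {Sc : Schedule} {Rlev Nc j₀ j₁ : ℕ} {Sfin : Finset V} {k : ℕ} {v : V} :
    v ∈ (rootWCD G φ w₀ Rt L' Sc Rlev Nc j₀ j₁ Sfin).Rim k ↔ v ∈ Win G φ w₀ (Sc.region k) Rt ∧ v ∉ graphBall G w₀ (Rt - L') :=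
  Finset.mem_filter

/-! ## §3 The root residue from the planar root band run -/

variable [DecidableEq V]

/-- **THE ROOT RESIDUE OF THE TWO-UNIT SCHEME OF RECORD FROM THE PLANAR ROOT BAND RUN** (design D″, (R)): `Skelφ.RootOblS` for
`⟨Skelφ.cellGeomSG G φ P w₀ Λ, q, δc⟩` from the rooted band schedule `rootSched` per direction read through `planarWindowWin hlip w₀ Rt`, the
chain data `rootWCD`; the planar facts, the rim parts inside the regions and the nonemptiness of the true targets are discharged; what remains
per direction is `RootBandOK`, three radius facts (+1 slack), `60 rmax ≤ Rt`, the level-window numerics, and the kit clauses / rim excess /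
first hop / count. [cite: KozmaNitzan2024, §4 p. 28 ((32) at the root), Lemma 11 (pp. 22–23)] -/
theorem rootOblS_of_rootRunSG (hlip : Lip G φ) (hstep : Steps G φ) (P : PCells2) (w₀ : V) {Λ : ConcRadiiG} (hΛ : WFS2 P Λ) (hφ : φ w₀ = 0)
    (q : unitInterval) (δc : ℝ) {Δ' : ℕ} {δr : ℕ → ℝ} {Rt L' : ℕ}
    {s₁ R' ℓ₀ N WM Rlev Nc j₀ j₁ : MDir → ℕ} {Wb : MDir → ℕ → ℕ} {ca cb q' ρ : MDir → ℤ}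
    (hOK : ∀ du, RootBandOK P du (s₁ du) (R' du) (ℓ₀ du) (N du) (WM du) (Wb du) (ca du) (cb du) (q' du) (ρ du))
    (hRl : ∀ du, Rlev du + 1 ≤ R' du) (hj : ∀ du, j₁ du ≤ Rlev du)
    (Sc : MDir → Schedule) (hSc : ∀ du, Sc du = rootSched P du (hOK du))
    (Pc : MDir → WinChainData V)
    (hPc : ∀ du, Pc du = rootWCD G φ w₀ Rt L' (Sc du) (Rlev du) (Nc du) (j₀ du) (j₁ du)
      (((⟨cellGeomSG G φ P w₀ Λ, q, δc⟩ : KSchA V ℕ).U0root du).filter fun y => y ∈ graphBall G w₀ Rt))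
    -- three radius facts (one unit of slack) and the depth of the window over the planar extent of the run
    (hRB : ∀ du, Rt + 1 ≤ Λ.rB 0 0 du) (hRQ : ∀ du, Rt + 1 ≤ Λ.rQ 0 ((0 : Site 2) + stepVec du))
    (hRM : ∀ du, Rt + 1 ≤ Λ.rM 0 ((0 : Site 2) + stepVec du)) (hRt : 60 * P.rmax ≤ Rt)
    -- the analytic inputs
    (hcount : ∀ du, 1 / (1 - (q : ℝ)) ^ (Δ' * (Pc du).N) ≤ δr (Sc du).N * ((Finset.Icc (Pc du).j₀ (Pc du).j₁).card : ℝ))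
    (hkits : ∀ du, ∀ k ≤ (Sc du).N, ∀ j ∈ Finset.Icc (Pc du).j₀ (Pc du).j₁, ∃ (σ : SData V) (Sz : Finset V),
      SHyp ((Pc du).stepL (planarWindowWin hlip w₀ Rt) (Sc du) k) j σ ∧ σ.N ≤ (Pc du).N ∧
      (1 - (q : ℝ) ^ σ.sB) ^ σ.k ≤ δr (Sc du).N ∧
      Sz ⊆ ((Pc du).stepL (planarWindowWin hlip w₀ Rt) (Sc du) k).X j ∧ Sz ⊆ (planarWindowWin hlip w₀ Rt).stepD (Sc du) k ∧
      (∀ x ∈ σ.K, ∀ e' ∈ σ.seed x, e' ∉ wireSet (↑Sz : Set V)) ∧ (∀ x ∈ σ.K, σ.face x ⊆ Sz) ∧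
      (∀ x ∈ σ.K, 1 - 3 * δr (Sc du).N ≤ (prodBernoulli ((⟨cellGeomSG G φ P w₀ Λ, q, δc⟩ : KSchA V ℕ).W0sub G
          (((⟨cellGeomSG G φ P w₀ Λ, q, δc⟩ : KSchA V ℕ).U0root du).filter fun y => y ∈ graphBall G w₀ Rt))).real
          {ω | ∃ u ∈ σ.face x,
        1 - δr (Sc du).N < (prodBernoulli (pinW ((⟨cellGeomSG G φ P w₀ Λ, q, δc⟩ : KSchA V ℕ).W0sub G
          (((⟨cellGeomSG G φ P w₀ Λ, q, δc⟩ : KSchA V ℕ).U0root du).filter fun y => y ∈ graphBall G w₀ Rt))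
          (wireSet (↑Sz : Set V)) ω)).real
          (⋃ t' ∈ (Pc du).coreE (planarWindowWin hlip w₀ Rt) (Sc du) k,
            openConnIn (↑((planarWindowWin hlip w₀ Rt).stepD (Sc du) k) : Set V) u t')}))
    {η : ℝ} (hη : ∀ du, η ≤ δr (Sc du).N / 2)
    (hexc : ∀ du, ∀ k ≤ (Sc du).N, (prodBernoulli ((⟨cellGeomSG G φ P w₀ Λ, q, δc⟩ : KSchA V ℕ).W0sub G
        (((⟨cellGeomSG G φ P w₀ Λ, q, δc⟩ : KSchA V ℕ).U0root du).filter fun y => y ∈ graphBall G w₀ Rt))).real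
        (⋃ t' ∈ (Pc du).Rim k, openConn w₀ t') ≤ η)
    {B₀ : MDir → Finset V} {Bpl : MDir → Finset (Site 2)}
    (hB₀ : ∀ du, B₀ du ⊆ Win G φ w₀ (Bpl du) Rt) (hBpl : ∀ du, Bpl du ⊆ (Sc du).core 0)
    (hsrc : ∀ du, 1 - δr (Sc du).N < (prodBernoulli ((⟨cellGeomSG G φ P w₀ Λ, q, δc⟩ : KSchA V ℕ).W0sub G
        (((⟨cellGeomSG G φ P w₀ Λ, q, δc⟩ : KSchA V ℕ).U0root du).filter fun y => y ∈ graphBall G w₀ Rt))).real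
        (⋃ t' ∈ B₀ du, openConn w₀ t')) :
    RootOblS G (⟨cellGeomSG G φ P w₀ Λ, q, δc⟩ : KSchA V ℕ) Δ' δr := by
  have hN : ∀ du, (Sc du).N = N du := fun du => by rw [hSc]; rfl
  have hR' : ∀ du, (Sc du).R' = R' du := fun du => by rw [hSc]; rfl
  -- the three planar facts
  have hreg : ∀ du, ∀ k ≤ (Sc du).N, (Sc du).region k ⊆ P.BtwN 0 du ∪ P.Q ((0 : Site 2) + stepVec du) := by
    intro du k hk; rw [hN] at hk; rw [hSc]; exact rootSched_region_subset (hOK du) hk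
  have hQ0 : ∀ du, ∀ k ≤ (Sc du).N, Disjoint ((Sc du).region k) (P.Q 0) := by
    intro du k hk; rw [hN] at hk; rw [hSc]; exact rootSched_region_disjoint_Q (hOK du) hk
  have hlast : ∀ du, (Sc du).core ((Sc du).N + 1) ⊆ P.M ((0 : Site 2) + stepVec du) := by
    intro du; rw [hN, hSc]; exact rootSched_core_last_subset_M (hOK du)
  refine rootOblS_concSG hlip hstep P w₀ hΛ hφ q δc (fun _ => Rt) Sc Pc B₀ (fun _ => η) (fun du => by rw [hPc]; rfl)
    (fun du => by rw [hPc]; rfl) (fun du => by rw [hR', hPc]; exact hRl du)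
    (fun du k => by rw [hPc]; exact rootWCD_Rim_subset hlip ..) (fun du => by rw [hPc]; exact hj du) (fun du k hk => ?_)
    hRB hRQ hRM hreg hQ0 hlast hcount hkits hη hexc (fun du => ?_) hsrc
  · -- the true targets are nonempty: a core point lies under a vertex of depth `≤ 60 rmax ≤ Rt` (`Steps`)
    obtain ⟨x, hx⟩ := (Sc du).core_nonempty (k := k + 1) (by omega)
    have hxr : x ∈ P.BtwN 0 du ∪ P.Q ((0 : Site 2) + stepVec du) := by
      have hk' : k + 1 ≤ N du + 1 := by rw [← hN]; omega
      have h' := rootSched_core_subset (hOK du) hk'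
      rw [← hSc] at h'
      exact h' hx
    obtain ⟨g, hg, hφg⟩ := exists_mem_graphBall_φ_eq hstep w₀ x
    simp only [hφ, Pi.zero_apply, sub_zero] at hg
    refine ⟨g, ?_⟩
    rw [PlanarWindow.coreT, planarWindowWin_W, mem_Win]
    exact ⟨graphBall_mono G w₀ ((natAbs_add_le_of_mem_root_region₂ P du hxr).trans hRt) hg, by rw [hφg]; exact hx⟩
  · -- the first-hop box lies in the first level
    rw [WinChainData.stepL_X_zero, planarWindowWin_W]
    exact (hB₀ du).trans (Win_mono G φ (hBpl du) le_rfl)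

end Skelφ

end Transplant

end Summit.CriticalPhenomena.PercolationContinuityZ3.Theorems

end
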